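import Summits.BirchSwinnertonDyer.BirchSwinnertonDyer.Theorems.PrintCf2SplitBadTwoStrictDefectReceptacle
import HarnessLib

/-!
# Crux `PrintCf2.SplitBadTwoRankOneOfFacts` (stmt-BirchSwinnertonDyer-20368), skeleton v13.1, stub S3d `stub_strictDefectAtVbar_two`
# (= route-C item 24036 `StrictDefectAtVbarTwo`) — class (iii) READER with the receptacle `H := W*` discharged:
# `ord₂ H'(0) = n + 2` on `d ≡ 3 (8)`, `n + 1` on `d ≡ 14 (16)`, modulo `j`, `(S_nr)_Γ = 0`, `𝔖 ≠ S_nr`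

Cell `bsd-print-cf2`, EXTRA WIDTH seat `bsd-line-cf2-p1-w3` g12 (prover-bsd-line-cf2-p1-w3-g12-0); `--supports stmt-BirchSwinnertonDyer-20368`
(helper, Theses-free). HONEST FRAMING: nothing here closes the crux or the registered stub S3d; BSD is not proved by any of this; no summit
statement is proved by this seat. No definition, no named fact, no `sorry`. Sequel of `…StrictDefectReceptacle` (this seat) and of -w3 g11's part IV
`…StrictDefectClassThreeSocket`.

WHAT. Part IV `StrictDefect.valuation_eq_add_of_natCard_endCoinvariants_eq_one_endEigenPrimaryTorsion` specialised to the receptacle `H := W*`,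
`ψ_H := (δ •) − 1` for `δ ∈ D_v̄` with `κ' δ = κ' γ'`, its three receptacle hypotheses `hH` / `hinv` / `hcoinvH` DISCHARGED by
`eq_top_of_not_finite_endEigenPrimaryTorsion_of_frame` / `natCard_endInvariants_smul_sub_one_eq_four_of_frame_three` (resp. `…_eq_two_of_frame_even_seven`) /
`subsingleton_endCoinvariants_smul_sub_one_of_frame_three` (resp. `…_even_seven`). What stays displayed: the spine data (`Dnr` finitely generated torsion with
`char = (H')`, `H'(0) ≠ 0`; any Agboola datum `D`), an additive INJECTION `j : Q = S_{W*}(K'_∞) ⧸ 𝔖 → W*` intertwining `conj_{γ'} − 1` with `(δ •) − 1`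
((DC) -w8 g4 + -w6 g5's evaluation at `φ₀`: (T1) injectivity, (T3) equivariance), `(S_{W*}(K'_∞))_Γ = 0` (-w4 g11 `UnrBaseLift.natCard_endCoinvariants_conjUnr_eq_one_of_frame`)
and `𝔖 ≠ S_{W*}(K'_∞)` (-w7 g5 `…_ne_top_of_frame_three` / `_of_level`).
* **`valuation_eq_add_two_of_frame_three`** (`d ≡ 3 (mod 8)`): `Module.Finite Λ D.X ∧ ∃ n, D.HasCharValuationAt n ∧ ord₂ H'(0) = n + 2`.
* **`valuation_eq_add_one_of_frame_even_seven`** (`d ≡ 14 (mod 16)`, `d` squarefree): the same with `n + 1`.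
(scrit R113's table `e_δ = (2, 0 ∣ 0, 0, 0, 1)`: these are the two non-zero entries.) presearch: as the receptacle file; no new fact. beyond-print theorem: no.

References: [GreenbergVatsal2000] §2 Cor. 2.3, Prop. 2.4 (pp. 20–22); [GreenbergLNM1716] §4 Lemma 4.2; [Agboola2007] §3 Prop. 3.2, §5.
-/

noncomputable section

open scoped Classical

-- the summit namespace `Summit.BirchSwinnertonDyer.BirchSwinnertonDyer` repeats the problem name by design (D-0017)
set_option linter.dupNamespace false
set_option autoImplicit false

open NumberField IsDedekindDomain Field
open Literature.NumberTheory.EllipticCurves Literature.NumberTheory.EllipticCurves.GreenbergSelmer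
open Literature.NumberTheory.EllipticCurves.GreenbergVatsal2000 Literature.NumberTheory.EllipticCurves.KellerYin2024
open Literature.NumberTheory.EllipticCurves.Agboola2007
open Literature.NumberTheory.EllipticCurves.IwasawaAlgebra Literature.NumberTheory.EllipticCurves.IwasawaDual
open Literature.NumberTheory.GaloisRepresentations

namespace Summit.BirchSwinnertonDyer.BirchSwinnertonDyer.Theorems.PrintCf2.StrictDefect

section Reader

open WeierstrassCurve
open Summit.BirchSwinnertonDyer.BirchSwinnertonDyer.Theorems.PrintCf2.RestrictedSelmerPair

variable {K : Type} [Field K] [NumberField K]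

/-- **S3d, class (iii), sub-class `d ≡ 3 (mod 8)`, RECEPTACLE DISCHARGED: `ord₂ H'(0) = n + 2`.** Frame: member `C • W = cm7^{(d)}`, `K` imaginary
quadratic, `2 = v v̄`, `π² = π − 2`, `r² = r − 2`, pinning clause at `v` for `W*`, line `κ'` unramified outside `v̄` with topological generator `γ'`, and
`δ ∈ D_v̄` with `κ' δ = κ' γ'`. Spine data: a Greenberg–Vatsal datum `Dnr` of `S_{W*}(K'_∞)` (finitely generated torsion, `char = (H')`, `H'(0) ≠ 0`) and
any Agboola datum `D`. Displayed arithmetic inputs: an additive INJECTION `j : Q = S_{W*}(K'_∞) ⧸ 𝔖 → W*` with `j ∘ (conj_{γ'} − 1) = ((δ •) − 1) ∘ j`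
((DC) + evaluation at `φ₀`), `(S_{W*}(K'_∞))_Γ = 0` (-w4 g11) and `𝔖 ≠ S_{W*}(K'_∞)` (-w7 g5). The receptacle inputs `hH`, `hinv` (`= 2 ^ 2`), `hcoinvH`
of part IV are §§2–3. [cite: GreenbergVatsal2000, §2 Cor. 2.3, Prop. 2.4 (pp. 20–22)] [cite: GreenbergLNM1716, §4 Lemma 4.2] [cite: Agboola2007, §3 Prop. 3.2, §5] -/
theorem valuation_eq_add_two_of_frame_three {d : ℤ} (hd0 : d ≠ 0) (hd8 : d % 8 = 3)
    (W : WeierstrassCurve ℚ) [W.IsElliptic] (C : VariableChange ℚ) (hC : C • W = cm7.quadraticTwist (d : ℚ)) (hK : IsImaginaryQuadratic K)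
    (v vbar : HeightOneSpectrum (𝓞 K)) (hv : ((2 : ℕ) : 𝓞 K) ∈ v.asIdeal) (hvbar : ((2 : ℕ) : 𝓞 K) ∈ vbar.asIdeal) (hne : vbar ≠ v)
    (π : (W.baseChange K).endRing) (hrel : (π : AddMonoid.End (W.baseChange K).geomPoints) * π = π - 2) {r : ℤ_[2]} (hr : r * r = r - 2)
    (hpin : ∀ τ ∈ GreenbergSelmer.inertia v, ∀ x : ↥((W.baseChange K).endEigenPrimaryTorsion 2 π r), τ • x = x ∨ τ • x = -x)
    (κ' : ZpExtension K 2) (hκ' : κ'.IsUnramifiedOutside vbar) {γ' : absoluteGaloisGroup K} (hγ' : κ'.IsTopGenerator γ')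
    {δ : absoluteGaloisGroup K} (hδD : δ ∈ GreenbergSelmer.decomp vbar) (hδγ : κ' δ = κ' γ')
    (Dnr : DatumDualData κ' γ' ↥((W.baseChange K).endEigenPrimaryTorsion 2 π r)
      (Castella2018.AcSelmer.bdpData ↥((W.baseChange K).endEigenPrimaryTorsion 2 π r) 2 vbar) ∅)
    [Module.Finite (IwasawaAlgebra 2) Dnr.X] (hXtor : Module.IsTorsion (IwasawaAlgebra 2) Dnr.X) {H' : IwasawaAlgebra 2}
    (hH' : Module.charIdeal (IwasawaAlgebra 2) Dnr.X = Ideal.span {H'}) (hH'0 : PowerSeries.constantCoeff H' ≠ 0)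
    (D : RestrictedDualData κ' ↥((W.baseChange K).endEigenPrimaryTorsion 2 π r) vbar γ')
    (j : unrSelmer κ' ↥((W.baseChange K).endEigenPrimaryTorsion 2 π r) vbar ∅ ⧸
        (restrictedSelmerZp κ' ↥((W.baseChange K).endEigenPrimaryTorsion 2 π r) vbar).addSubgroupOf
          (unrSelmer κ' ↥((W.baseChange K).endEigenPrimaryTorsion 2 π r) vbar ∅) →+
        ↥((W.baseChange K).endEigenPrimaryTorsion 2 π r))
    (hj : Function.Injective j)
    (hje : ∀ q, j (QuotientAddGroup.map _ _
        ((conjUnr κ' ↥((W.baseChange K).endEigenPrimaryTorsion 2 π r) vbar ∅ γ' - 1 :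
            AddMonoid.End (unrSelmer κ' ↥((W.baseChange K).endEigenPrimaryTorsion 2 π r) vbar ∅)) :
          unrSelmer κ' ↥((W.baseChange K).endEigenPrimaryTorsion 2 π r) vbar ∅ →+
            unrSelmer κ' ↥((W.baseChange K).endEigenPrimaryTorsion 2 π r) vbar ∅)
        (addSubgroupOf_le_comap_conjUnr_sub_one κ' ↥((W.baseChange K).endEigenPrimaryTorsion 2 π r) vbar γ') q) =
      (DistribMulAction.toAddMonoidEnd (absoluteGaloisGroup K) ↥((W.baseChange K).endEigenPrimaryTorsion 2 π r) δ - 1) (j q))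
    (hcoinv : Nat.card (EndCoinvariants
      (conjUnr κ' ↥((W.baseChange K).endEigenPrimaryTorsion 2 π r) vbar (∅ : Set (HeightOneSpectrum (𝓞 K))) γ' - 1)) = 1)
    (hN : (restrictedSelmerZp κ' ↥((W.baseChange K).endEigenPrimaryTorsion 2 π r) vbar).addSubgroupOf
      (unrSelmer κ' ↥((W.baseChange K).endEigenPrimaryTorsion 2 π r) vbar ∅) ≠ ⊤) :
    Module.Finite (IwasawaAlgebra 2) D.X ∧
    ∃ n : ℕ, D.HasCharValuationAt n ∧ (PowerSeries.constantCoeff H').valuation = n + 2 := by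
  have hδ : κ'.IsTopGenerator δ := by rw [ZpExtension.IsTopGenerator, hδγ]; exact hγ'
  exact valuation_eq_add_of_natCard_endCoinvariants_eq_one_endEigenPrimaryTorsion (W.baseChange K) π r hγ' Dnr hXtor hH' hH'0 D
    (DistribMulAction.toAddMonoidEnd (absoluteGaloisGroup K) ↥((W.baseChange K).endEigenPrimaryTorsion 2 π r) δ - 1)
    (eq_top_of_not_finite_endEigenPrimaryTorsion_of_frame hd0 W C hC π hrel hr) j hj hje
    (natCard_endInvariants_smul_sub_one_eq_four_of_frame_three hd0 hd8 W C hC hK v vbar hv hvbar hne π hrel hr hpin κ' hκ' hδD hδ)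
    (subsingleton_endCoinvariants_smul_sub_one_of_frame_three hd0 hd8 W C hC hK v vbar hv hvbar hne π hrel hr hpin κ' hκ' hδD hδ)
    hcoinv hN

/-- **S3d, class (iii), sub-class `d ≡ 14 (mod 16)` (`d = 2d'`, `d' ≡ 7 (8)`, `d` squarefree), RECEPTACLE DISCHARGED: `ord₂ H'(0) = n + 1`.**
Same frame and displayed inputs as `valuation_eq_add_two_of_frame_three`; here `#W*^{D_v̄} = 2` (B15), so `a = 1`.
[cite: GreenbergVatsal2000, §2 Cor. 2.3, Prop. 2.4 (pp. 20–22)] [cite: GreenbergLNM1716, §4 Lemma 4.2] [cite: Agboola2007, §3 Prop. 3.2, §5] -/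
theorem valuation_eq_add_one_of_frame_even_seven {d : ℤ} (hd0 : d ≠ 0) (hsq : Squarefree d)
    (h2d : (2 : ℤ) ∣ d) (hd7 : (d / 2) % 8 = 7)
    (W : WeierstrassCurve ℚ) [W.IsElliptic] (C : VariableChange ℚ) (hC : C • W = cm7.quadraticTwist (d : ℚ)) (hK : IsImaginaryQuadratic K)
    (v vbar : HeightOneSpectrum (𝓞 K)) (hv : ((2 : ℕ) : 𝓞 K) ∈ v.asIdeal) (hvbar : ((2 : ℕ) : 𝓞 K) ∈ vbar.asIdeal) (hne : vbar ≠ v)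
    (π : (W.baseChange K).endRing) (hrel : (π : AddMonoid.End (W.baseChange K).geomPoints) * π = π - 2) {r : ℤ_[2]} (hr : r * r = r - 2)
    (hpin : ∀ τ ∈ GreenbergSelmer.inertia v, ∀ x : ↥((W.baseChange K).endEigenPrimaryTorsion 2 π r), τ • x = x ∨ τ • x = -x)
    (κ' : ZpExtension K 2) (hκ' : κ'.IsUnramifiedOutside vbar) {γ' : absoluteGaloisGroup K} (hγ' : κ'.IsTopGenerator γ')
    {δ : absoluteGaloisGroup K} (hδD : δ ∈ GreenbergSelmer.decomp vbar) (hδγ : κ' δ = κ' γ')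
    (Dnr : DatumDualData κ' γ' ↥((W.baseChange K).endEigenPrimaryTorsion 2 π r)
      (Castella2018.AcSelmer.bdpData ↥((W.baseChange K).endEigenPrimaryTorsion 2 π r) 2 vbar) ∅)
    [Module.Finite (IwasawaAlgebra 2) Dnr.X] (hXtor : Module.IsTorsion (IwasawaAlgebra 2) Dnr.X) {H' : IwasawaAlgebra 2}
    (hH' : Module.charIdeal (IwasawaAlgebra 2) Dnr.X = Ideal.span {H'}) (hH'0 : PowerSeries.constantCoeff H' ≠ 0)
    (D : RestrictedDualData κ' ↥((W.baseChange K).endEigenPrimaryTorsion 2 π r) vbar γ')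
    (j : unrSelmer κ' ↥((W.baseChange K).endEigenPrimaryTorsion 2 π r) vbar ∅ ⧸
        (restrictedSelmerZp κ' ↥((W.baseChange K).endEigenPrimaryTorsion 2 π r) vbar).addSubgroupOf
          (unrSelmer κ' ↥((W.baseChange K).endEigenPrimaryTorsion 2 π r) vbar ∅) →+
        ↥((W.baseChange K).endEigenPrimaryTorsion 2 π r))
    (hj : Function.Injective j)
    (hje : ∀ q, j (QuotientAddGroup.map _ _
        ((conjUnr κ' ↥((W.baseChange K).endEigenPrimaryTorsion 2 π r) vbar ∅ γ' - 1 :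
            AddMonoid.End (unrSelmer κ' ↥((W.baseChange K).endEigenPrimaryTorsion 2 π r) vbar ∅)) :
          unrSelmer κ' ↥((W.baseChange K).endEigenPrimaryTorsion 2 π r) vbar ∅ →+
            unrSelmer κ' ↥((W.baseChange K).endEigenPrimaryTorsion 2 π r) vbar ∅)
        (addSubgroupOf_le_comap_conjUnr_sub_one κ' ↥((W.baseChange K).endEigenPrimaryTorsion 2 π r) vbar γ') q) =
      (DistribMulAction.toAddMonoidEnd (absoluteGaloisGroup K) ↥((W.baseChange K).endEigenPrimaryTorsion 2 π r) δ - 1) (j q))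
    (hcoinv : Nat.card (EndCoinvariants
      (conjUnr κ' ↥((W.baseChange K).endEigenPrimaryTorsion 2 π r) vbar (∅ : Set (HeightOneSpectrum (𝓞 K))) γ' - 1)) = 1)
    (hN : (restrictedSelmerZp κ' ↥((W.baseChange K).endEigenPrimaryTorsion 2 π r) vbar).addSubgroupOf
      (unrSelmer κ' ↥((W.baseChange K).endEigenPrimaryTorsion 2 π r) vbar ∅) ≠ ⊤) :
    Module.Finite (IwasawaAlgebra 2) D.X ∧
    ∃ n : ℕ, D.HasCharValuationAt n ∧ (PowerSeries.constantCoeff H').valuation = n + 1 := by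
  have hδ : κ'.IsTopGenerator δ := by rw [ZpExtension.IsTopGenerator, hδγ]; exact hγ'
  exact valuation_eq_add_of_natCard_endCoinvariants_eq_one_endEigenPrimaryTorsion (W.baseChange K) π r hγ' Dnr hXtor hH' hH'0 D
    (DistribMulAction.toAddMonoidEnd (absoluteGaloisGroup K) ↥((W.baseChange K).endEigenPrimaryTorsion 2 π r) δ - 1)
    (eq_top_of_not_finite_endEigenPrimaryTorsion_of_frame hd0 W C hC π hrel hr) j hj hje
    (natCard_endInvariants_smul_sub_one_eq_two_of_frame_even_seven hd0 hsq h2d hd7 W C hC hK v vbar hv hvbar hne π hrel hr hpin κ' hκ' hδD hδ)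
    (subsingleton_endCoinvariants_smul_sub_one_of_frame_even_seven hd0 hsq h2d hd7 W C hC hK v vbar hv hvbar hne π hrel hr hpin κ' hκ'
      hδD hδ)
    hcoinv hN

end Reader

end Summit.BirchSwinnertonDyer.BirchSwinnertonDyer.Theorems.PrintCf2.StrictDefect

end
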